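import Summits.AnomalousDissipation.AnomalousDissipation.Theses.MirrorVariety
import Literature.Analysis.FunctionSpaces.TorusIntegerEndomorphism

/-!
# Line `stagnation-plug-froth` — crux `MirrorVariety.TaylorGreenLoudGalerkinStates` (stmt-AnomalousDissipation-2987)

Crux (fixed, the route's): for the Taylor–Green force `f_TG` there are `ν_j → 0⁺`, `E`, `ε > 0` with,
for every `j` and ALL large resolutions `N`, a loud bounded Fourier–Galerkin steady state
(`∫|U|² ≤ E`, `ν_j‖∇U‖² ≥ ε`, tested Galerkin equations against every band-limited smooth div-free `a`).

Idea `stagnation-plug-froth` (crux-ideate r1, ideator 1; triage r1-1: pass, tests A1–A5): make the loud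
steady states CONSTRUCTIVELY inside the Taylor–Green mirror class `K` — thin strained vortex rings held
stationary ("station-holding") at the hyperbolic stagnation points pinned by the reflection lattice of
`f_TG`, nested aperture-in-aperture down to the Kolmogorov scale ("froth"), the lattice symmetry removing
the translational zero modes of every ring ("plug" = nondegeneracy in the `K`-symmetric class) — and
transfer them to ALL large `N` by Galerkin approximation of nondegenerate solutions
(Brezzi–Rappaz–Raviart 1980) plus symmetric criticality.

Skeleton (this file; `sorry` only inside `stub_*`):

* `stub_froth` — LOAD-BEARING (the idea, PDE level, honest per triage T3/sharpen): along `ν_j → 0⁺` a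
  family of smooth div-free mean-zero `K`-symmetric QUASI-solutions `v_j` of steady NS(`ν_j`, `f_TG`) with
  energy `≤ E₁`, loudness `ν_j‖∇v_j‖² ≥ ε₁`, steady residual `≤ η_j` in the dual energy norm on `K`-fields,
  and an inf-sup constant `M_j` for the linearised steady operator on `K`-fields, such that the
  Kantorovich product `M_j²η_j` and the margins `(M_jη_j)²/E₁`, `ν_j(M_jη_j)²/ε₁` are as small as asked
  (`∀ c > 0`: pass to a tail of the construction).
* `stub_galerkinNewton` — Brezzi–Rappaz–Raviart + Newton–Kantorovich, general force (also serves line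
  `depth-dichotomy-lanford`'s `NondegenerateTransfer`): a Newton-ready quasi-solution at fixed `ν` has, for
  all large `N`, a `K`-symmetric band-limited Galerkin steady state solving the `K`-tested equations with
  `∫|U|² ≤ 4E₁`, `ν‖∇U‖² ≥ ε₁/4` (universal constant `c` = Kantorovich threshold from the Sobolev constant
  of `T³`; discrete inf-sup stability of the truncated linearisation = compact perturbation of Stokes).
* `stub_criticality` — Palais symmetric criticality, finite-dimensional: for a `K`-symmetric force a
  `K`-symmetric band-limited field solving the `K`-tested Galerkin equations solves them against every
  band-limited smooth div-free test (average the test over `K`; reflections preserve `|k|`).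
* `stub_tgForceRegular` — `f_TG` is smooth, divergence-free, mean-zero and `K`-symmetric (Stokes modes on
  the shell `|k|² = 3`; triage T1, needed for 2987 → 2986 anyway).
* `TaylorGreenLoudGalerkinStates_of` — the kernel-checked composition (pure logic: `E := 4E₁`, `ε := ε₁/4`).

`K` here := the three coordinate reflections `x_i ↦ -x_i` of `T³` acting on vector fields by
`(ρ_i u)(x) = R_i u(R_i x)`, `R_i = diag(…,-1,…)` (via the tree's `Torus.mulVecT`): `f_TG` is `K`-invariant,
the fixed lattice `{0,½}³` consists of stagnation points of every `K`-field and the planes `x_i ∈ {0,½}` are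
impermeable (Brachet et al. 1983 "impermeable box"). The lead may enlarge `K` (half-period translations,
the `π/2`-rotation about `x = y = ¼`) without changing the composition.

Remarks for the lead.
* `stub_froth` with `η_j = 0` is exactly "K-symmetric, K-nondegenerate, bounded, loud EXACT steady states
  for `f_TG`" (triage T3 sharpening); the quasi-solution form is what a gluing construction delivers. Via
  continuous Newton it also yields `CoherentStates.SteadyZerothLaw` (stmt-0219) / `FrozenK41.SteadyWitness`
  — recorded, not used here.
* The local vocabulary (`tgForce`, `reflMat`, `actVec`, `IsKSymm`, `IsKField`, `IsBandLimited`,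
  `testedForm`, `linForm`; ~40 lines, self-contained) is flagged `tree.vendored-fact` by the file audit
  (Prop-valued defs under `Summit.*`): before the first stub proof is proposed, vendor it verbatim into a
  Literature support file (e.g. `Literature/Analysis/FluidPDE/TaylorGreenSymmetry.lean`) and re-point the
  skeleton; statements do not change.
* Input degradation: the idea-card BODY was not readable from this seat (evidence store not mounted; same
  for triage r1-1); the skeleton realises the card's one-paragraph summary + the triage's T1–T3/A1–A5.

Disproof used: none available at planning time (`ledger crux cat stmt-AnomalousDissipation-2987
Disproof.lean` → no workfile; no `Theorems/TaylorGreenLoudGalerkinStates/Negative/` lemmas landed).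
Negatives index (13037, 2859, 2979, 2984): none is an instance of a stub below.
-/

noncomputable section

set_option linter.dupNamespace false

open scoped BigOperators Topology Classical MeasureTheory InnerProductSpace ComplexConjugate ContinuousMap
open Filter MeasureTheory
open Literature.Analysis.FunctionSpaces Literature.Analysis.FunctionSpaces.Torus

namespace Summit.AnomalousDissipation.AnomalousDissipation.Cruxes.TaylorGreenLoudGalerkinStates.StagnationPlugFroth

/-! ## Local vocabulary (transparent abbreviations of the crux's own clauses) -/

/-- The Taylor–Green force `f_TG = (sin2πx₀ cos2πx₁ cos2πx₂, −cos2πx₀ sin2πx₁ cos2πx₂, 0)`, verbatim the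
field of the crux (`(fourier 1 t).im = sin 2πt`, `.re = cos 2πt`). -/
abbrev tgForce : UnitAddTorus (Fin 3) → EuclideanSpace ℝ (Fin 3) := fun x =>
  !₂[(fourier 1 (x 0) : ℂ).im * (fourier 1 (x 1) : ℂ).re * (fourier 1 (x 2) : ℂ).re,
    -((fourier 1 (x 0) : ℂ).re * (fourier 1 (x 1) : ℂ).im * (fourier 1 (x 2) : ℂ).re), (0 : ℝ)]

/-- The reflection matrix `R_i = diag(1,…,-1 (slot i),…,1) ∈ M₃(ℤ)`. -/
def reflMat (i : Fin 3) : Matrix (Fin 3) (Fin 3) ℤ :=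
  Matrix.diagonal fun k => if k = i then -1 else 1

/-- Action of an integer matrix on vectors of `ℝ³` (the differential of `Torus.mulVecT M`). -/
def actVec (M : Matrix (Fin 3) (Fin 3) ℤ) (v : EuclideanSpace ℝ (Fin 3)) : EuclideanSpace ℝ (Fin 3) :=
  WithLp.toLp 2 ((M.map (Int.cast : ℤ → ℝ)).mulVec (WithLp.ofLp v))

/-- `K`-symmetry: equivariance under the three coordinate reflections of `T³`,
`u (R_i x) = R_i (u x)` — the mirror group of the Taylor–Green force. -/
def IsKSymm (u : UnitAddTorus (Fin 3) → EuclideanSpace ℝ (Fin 3)) : Prop :=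
  ∀ (i : Fin 3) (x : UnitAddTorus (Fin 3)), u (Torus.mulVecT (reflMat i) x) = actVec (reflMat i) (u x)

/-- A `K`-field: smooth, divergence-free, mean-zero and `K`-symmetric. -/
def IsKField (u : UnitAddTorus (Fin 3) → EuclideanSpace ℝ (Fin 3)) : Prop :=
  IsSmooth u ∧ IsDivFree u ∧ HasZeroMean u ∧ IsKSymm u

/-- Band-limitation to the punctured frequency ball `0 < |k| ≤ N` (verbatim the crux's clause). -/
def IsBandLimited (N : ℕ) (U : UnitAddTorus (Fin 3) → EuclideanSpace ℝ (Fin 3)) : Prop :=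
  ∀ k ∉ (freqBall N).erase (0 : Fin 3 → ℤ), UnitAddTorus.mFourierCoeff (EuclideanSpace.complexify ∘ U) k = 0

/-- The tested steady Navier–Stokes form of the crux, `∫ ⟪U,(U·∇)a⟫ + ν⟪U,Δa⟫ + ⟪f,a⟫`
(zero for all admissible `a` = `U` is a steady state; for a quasi-solution it is the residual paired with `a`). -/
def testedForm (ν : ℝ) (f U a : UnitAddTorus (Fin 3) → EuclideanSpace ℝ (Fin 3)) : ℝ :=
  ∫ x, (inner ℝ (U x) (convect U a x) + ν * inner ℝ (U x) (laplacian a x) + inner ℝ (f x) (a x))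

/-- The linearisation of `testedForm ν f · a` at `v` in the direction `w`
(`U ↦ ⟪U,(U·∇)a⟫` is quadratic): `∫ ⟪w,(v·∇)a⟫ + ⟪v,(w·∇)a⟫ + ν⟪w,Δa⟫`. -/
def linForm (ν : ℝ) (v w a : UnitAddTorus (Fin 3) → EuclideanSpace ℝ (Fin 3)) : ℝ :=
  ∫ x, (inner ℝ (w x) (convect v a x) + inner ℝ (v x) (convect w a x) + ν * inner ℝ (w x) (laplacian a x))

/-! ## Registered stubs -/

/-- **stub_froth** (LOAD-BEARING; size XL / open-problem-hard; the idea `stagnation-plug-froth` itself,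
stated honestly at the PDE level as triage T3 asks, but as NEWTON DATA rather than as exact solutions).
Along some `ν_j → 0⁺` there are `K`-symmetric smooth div-free mean-zero quasi-solutions `v_j` of steady
NS(`ν_j`, `f_TG`) — informally: the TG cell flow plus station-holding thin strained rings plugged at the
hyperbolic stagnation points of the reflection lattice, nested aperture-in-aperture down to the
Kolmogorov scale — with (i) energy `∫|v_j|² ≤ E₁` and loudness `ν_j‖∇v_j‖² ≥ ε₁` uniformly in `j`
(froth budget: every generation adds `O(α_kΓ_k²)` dissipation at geometric energy cost — must beat the
single-skeleton log-ceiling, triage ★A1, and must NOT produce a uniformly-`BV` limit, triage ★A4 /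
`Literature.Barriers.AnomalousDissipation.DeRosaInversi2024_thm12`), (ii) steady residual `≤ η_j` in the
dual energy norm on `K`-fields, (iii) an inf-sup constant `M_j` for the linearised steady operator
`linForm (ν j) (v j)` on `K`-fields (the "plug": in the `K`-class the rings have no translation/tilt
zero modes; closed-ring station-holding needs axial core flow, triage A2; no axisymmetric reduction
survives Prandtl–Batchelor, triage A3), and (iv) Newton smallness: `M_j²η_j`, `(M_jη_j)²/E₁`,
`ν_j(M_jη_j)²/ε₁` below any prescribed `c > 0` (i.e. they tend to `0` along the construction — pass to a
tail). Why plausibly true: Burgers-type cores are exact local steady balances with `ν`-independent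
dissipation per length (Frisch1995 §8.9.1 (8.140); GallayWayne2006, GallayMaekawa2010 for existence and
local stability = local invertibility), and gluing exact local pieces with geometric accuracy is the
Davila–del Pino–Musso–Wei inner/outer scheme (arXiv:2007.00606); the linearised invertibility at each
ring is the Gallay–Wayne spectral gap, the global coupling is weak for thin cores. Why it might fail:
A1 (log-quiet generations ⇒ depth `≍ log(1/ν)` with holding strain supplied only by the parent
generation: Andreotti–Douady–Couder strained arrays are steady only for `19 ≲ Re ≲ 45`; Kerr2024 §6),
A2, A3, A4 above; and `M_j` typically grows like `exp(depth)` while `η_j` must beat it. -/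
theorem stub_froth :
    ∀ c : ℝ, 0 < c →
      ∃ (ν : ℕ → ℝ) (v : ℕ → UnitAddTorus (Fin 3) → EuclideanSpace ℝ (Fin 3)) (E₁ ε₁ : ℝ) (η M : ℕ → ℝ),
        (∀ j, 0 < ν j) ∧ Filter.Tendsto ν Filter.atTop (nhds 0) ∧ 0 < ε₁ ∧
        ∀ j, IsKField (v j) ∧ ∫ x, ‖v j x‖ ^ 2 ≤ E₁ ∧ ε₁ ≤ ν j * gradNormSq (v j) ∧
          (∀ a, IsKField a → |testedForm (ν j) tgForce (v j) a| ≤ η j * Real.sqrt (gradNormSq a)) ∧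
          (∀ w, IsKField w → ∃ a, IsKField a ∧
              Real.sqrt (gradNormSq w) * Real.sqrt (gradNormSq a) ≤ M j * linForm (ν j) (v j) w a ∧
              (0 < gradNormSq w → 0 < gradNormSq a)) ∧
          M j ^ 2 * η j ≤ c ∧ (M j * η j) ^ 2 ≤ c * E₁ ∧ ν j * (M j * η j) ^ 2 ≤ c * ε₁ := by
  sorry

/-- **stub_galerkinNewton** (size XL; Brezzi–Rappaz–Raviart 1980, doi:10.1007/bf01395985, Part I
Thm. 3-type Galerkin approximation of nonsingular solutions + Newton–Kantorovich, tree
`Literature/Analysis/Calculus/SimplifiedNewton.lean`; Girault–Raviart 1986 Ch. IV §3). GENERAL force `f`: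
if `v` is a `K`-field with energy `≤ E₁`, loudness `≥ ε₁`, steady residual `≤ η` in the dual energy norm
on `K`-fields and inf-sup constant `M` for `linForm ν v` on `K`-fields, and the three smallness conditions
hold with the universal constant `c` (depends only on the Sobolev/Ladyzhenskaya constant `C_B` of `T³` and
Poincaré `2π`), then for all large `N` the `K`-symmetric Fourier–Galerkin steady problem on the punctured
ball has a solution `U` with `‖∇(U − P_N v)‖ ≤ 4M(η + o(1))`, whence `∫|U|² ≤ 4E₁` and `ν‖∇U‖² ≥ ε₁/4`.
Proof route: (1) `P_N` (Fourier truncation) commutes with Stokes and with `K` (reflections preserve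
`|k|`), maps `K`-fields to band-limited `K`-fields, `P_N v → v` in `H¹`; (2) continuous inf-sup on the
dense class of smooth `K`-fields ⇒ `T_v = -νA + (compact)` is injective with `‖T_v⁻¹‖ ≤ M` on `V_K`
(Fredholm index 0) ⇒ discrete inf-sup `‖(P_N T_v P_N)⁻¹‖ ≤ 2M` for `N ≥ N₀(v, ν)` (BRR); (3) residual of
`P_N v` in `(X_N^K)'` is `≤ η + C_B(2‖v‖_V)‖v − P_N v‖_V`; (4) Kantorovich `h = (2M)²·2C_B·η_N ≤ 1/2`;
(5) margins by Poincaré and the triangle inequality. Why it might fail: only through mis-typing (e.g.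
the existential inf-sup witness form loses an arbitrarily small amount of `M` — absorbed by `c`). -/
theorem stub_galerkinNewton :
    ∃ c : ℝ, 0 < c ∧
      ∀ (ν E₁ ε₁ η M : ℝ) (f v : UnitAddTorus (Fin 3) → EuclideanSpace ℝ (Fin 3)),
        0 < ν → IsSmooth f → IsKField v →
        ∫ x, ‖v x‖ ^ 2 ≤ E₁ → ε₁ ≤ ν * gradNormSq v →
        (∀ a, IsKField a → |testedForm ν f v a| ≤ η * Real.sqrt (gradNormSq a)) →
        (∀ w, IsKField w → ∃ a, IsKField a ∧
            Real.sqrt (gradNormSq w) * Real.sqrt (gradNormSq a) ≤ M * linForm ν v w a ∧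
            (0 < gradNormSq w → 0 < gradNormSq a)) →
        M ^ 2 * η ≤ c → (M * η) ^ 2 ≤ c * E₁ → ν * (M * η) ^ 2 ≤ c * ε₁ →
        ∀ᶠ N in Filter.atTop, ∃ U : UnitAddTorus (Fin 3) → EuclideanSpace ℝ (Fin 3),
          IsKField U ∧ IsBandLimited N U ∧
          (∀ a, IsSmooth a → IsDivFree a → IsKSymm a → IsBandLimited N a → testedForm ν f U a = 0) ∧
          ∫ x, ‖U x‖ ^ 2 ≤ 4 * E₁ ∧ ε₁ / 4 ≤ ν * gradNormSq U := by
  sorry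

/-- **stub_criticality** (size M; Palais' principle of symmetric criticality in finite dimensions).
For a smooth `K`-symmetric force `f`, a `K`-field `U` band-limited to `0 < |k| ≤ N` that solves the
tested Galerkin equations against all band-limited smooth div-free `K`-SYMMETRIC tests solves them
against ALL band-limited smooth div-free tests. Proof route: symmetrise the test one reflection at a
time, `a ↦ (a + ρ_i a)/2` (`ρ_i a = R_i ∘ a ∘ R_i`; the reflections commute, preserve smoothness,
div-freeness and the frequency ball since `|R_i k| = |k|`), and show `testedForm ν f U (ρ_i a) =
testedForm ν f U a` for `K`-symmetric `U`, `f` by the measure-preserving change of variables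
`x ↦ R_i x` (`Torus.measurePreserving_mulVecT`, `Torus.fderiv_comp_mulVecT`) and equivariance of
`convect`/`laplacian`; `testedForm` is linear in `a`. (The ideator's first lemma `KSymmetricCriticality`;
triage T2(ii): true, cheap, not load-bearing.) -/
theorem stub_criticality :
    ∀ (ν : ℝ) (N : ℕ) (f U : UnitAddTorus (Fin 3) → EuclideanSpace ℝ (Fin 3)),
      IsSmooth f → IsKSymm f → IsKField U → IsBandLimited N U →
      (∀ a, IsSmooth a → IsDivFree a → IsKSymm a → IsBandLimited N a → testedForm ν f U a = 0) →
      ∀ a, IsSmooth a → IsDivFree a → IsBandLimited N a → testedForm ν f U a = 0 := by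
  sorry

/-- **stub_tgForceRegular** (size S–M; triage T1; cf. `LambCircleTG.TGForceRegular` for the sibling
force `f♯`). The Taylor–Green force is smooth, divergence-free (`2π cos·cos·cos − 2π cos·cos·cos = 0`),
mean-zero and `K`-symmetric (`sin` odd / `cos` even under `x_i ↦ -x_i`). Proof route: expand into Stokes
modes on the shell `|k|² = 3` and use `Torus.isSmooth_stokesMode / isDivFree_stokesMode /
hasZeroMean_stokesMode`, or directly via `fourier` calculus (`BeltramiWavesCurl.curl_realTrigPoly`). -/
theorem stub_tgForceRegular :
    IsKField tgForce := by
  sorry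

/-! ## Composition (kernel-checked; no `sorry` outside the four stubs) -/

/-- **The line closes the crux.** Logical shape: `stub_froth → stub_galerkinNewton → stub_criticality →
stub_tgForceRegular → MirrorVariety.TaylorGreenLoudGalerkinStates` (the four statements are restated
verbatim as `have`s and used only through them, so the composition is pure logic): take the Kantorovich
threshold `c` of the Newton stub, the froth family for that `c`, `E := 4E₁`, `ε := ε₁/4`; at each `j` the
Newton stub gives the `K`-Galerkin states for all large `N`, criticality upgrades the `K`-tested equations
to the crux's tested equations, and `f = f_TG` is substituted. Stated WITHOUT hypotheses and concluding
the route decl BY NAME, as `#h21_check_skeleton` requires. -/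
theorem TaylorGreenLoudGalerkinStates_of :
    Summit.AnomalousDissipation.AnomalousDissipation.Theses.MirrorVariety.TaylorGreenLoudGalerkinStates := by
  have hfroth :
    ∀ c : ℝ, 0 < c →
      ∃ (ν : ℕ → ℝ) (v : ℕ → UnitAddTorus (Fin 3) → EuclideanSpace ℝ (Fin 3)) (E₁ ε₁ : ℝ) (η M : ℕ → ℝ),
        (∀ j, 0 < ν j) ∧ Filter.Tendsto ν Filter.atTop (nhds 0) ∧ 0 < ε₁ ∧
        ∀ j, IsKField (v j) ∧ ∫ x, ‖v j x‖ ^ 2 ≤ E₁ ∧ ε₁ ≤ ν j * gradNormSq (v j) ∧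
          (∀ a, IsKField a → |testedForm (ν j) tgForce (v j) a| ≤ η j * Real.sqrt (gradNormSq a)) ∧
          (∀ w, IsKField w → ∃ a, IsKField a ∧
              Real.sqrt (gradNormSq w) * Real.sqrt (gradNormSq a) ≤ M j * linForm (ν j) (v j) w a ∧
              (0 < gradNormSq w → 0 < gradNormSq a)) ∧
          M j ^ 2 * η j ≤ c ∧ (M j * η j) ^ 2 ≤ c * E₁ ∧ ν j * (M j * η j) ^ 2 ≤ c * ε₁ := stub_froth
  have hnewton :
    ∃ c : ℝ, 0 < c ∧
      ∀ (ν E₁ ε₁ η M : ℝ) (f v : UnitAddTorus (Fin 3) → EuclideanSpace ℝ (Fin 3)),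
        0 < ν → IsSmooth f → IsKField v →
        ∫ x, ‖v x‖ ^ 2 ≤ E₁ → ε₁ ≤ ν * gradNormSq v →
        (∀ a, IsKField a → |testedForm ν f v a| ≤ η * Real.sqrt (gradNormSq a)) →
        (∀ w, IsKField w → ∃ a, IsKField a ∧
            Real.sqrt (gradNormSq w) * Real.sqrt (gradNormSq a) ≤ M * linForm ν v w a ∧
            (0 < gradNormSq w → 0 < gradNormSq a)) →
        M ^ 2 * η ≤ c → (M * η) ^ 2 ≤ c * E₁ → ν * (M * η) ^ 2 ≤ c * ε₁ →
        ∀ᶠ N in Filter.atTop, ∃ U : UnitAddTorus (Fin 3) → EuclideanSpace ℝ (Fin 3),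
          IsKField U ∧ IsBandLimited N U ∧
          (∀ a, IsSmooth a → IsDivFree a → IsKSymm a → IsBandLimited N a → testedForm ν f U a = 0) ∧
          ∫ x, ‖U x‖ ^ 2 ≤ 4 * E₁ ∧ ε₁ / 4 ≤ ν * gradNormSq U := stub_galerkinNewton
  have hcrit :
    ∀ (ν : ℝ) (N : ℕ) (f U : UnitAddTorus (Fin 3) → EuclideanSpace ℝ (Fin 3)),
      IsSmooth f → IsKSymm f → IsKField U → IsBandLimited N U →
      (∀ a, IsSmooth a → IsDivFree a → IsKSymm a → IsBandLimited N a → testedForm ν f U a = 0) →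
      ∀ a, IsSmooth a → IsDivFree a → IsBandLimited N a → testedForm ν f U a = 0 := stub_criticality
  have htg : IsKField tgForce := stub_tgForceRegular
  -- pure logic from here on
  intro f hf
  obtain ⟨c, hc, hN⟩ := hnewton
  obtain ⟨ν, v, E₁, ε₁, η, M, hνpos, hνlim, hε₁, hj⟩ := hfroth c hc
  obtain ⟨htgs, htgd, htgz, htgk⟩ := htg
  refine ⟨ν, 4 * E₁, ε₁ / 4, hνpos, hνlim, by positivity, fun j => ?_⟩
  obtain ⟨hv, hen, hloud, hres, hinf, hs₁, hs₂, hs₃⟩ := hj j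
  have hev := hN (ν j) E₁ ε₁ (η j) (M j) tgForce (v j) (hνpos j) htgs hv hen hloud hres hinf hs₁ hs₂ hs₃
  subst hf
  refine hev.mono ?_
  rintro N ⟨U, hU, hband, htest, hUen, hUloud⟩
  obtain ⟨hUs, hUd, hUz, hUk⟩ := hU
  exact ⟨U, ⟨hUs, hUd, hUz, hband, fun a ha hda hba =>
    hcrit (ν j) N tgForce U htgs htgk ⟨hUs, hUd, hUz, hUk⟩ hband htest a ha hda hba⟩, hUen, hUloud⟩

end Summit.AnomalousDissipation.AnomalousDissipation.Cruxes.TaylorGreenLoudGalerkinStates.StagnationPlugFroth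

end
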